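import Summits.ValiantsHypothesis.ValiantsHypothesis.Theses.FermionizationDimension

/-!
# Route FermionizationDimension — crux `SDimPerNotQP` (stmt-ValiantsHypothesis-7286):
# calibration L — the local (nilpotent / junta) expansion bound

Stub `stub_localExpansion` of the line `registered` of `Cruxes/SDimPerNotQP/Lines/birth.lean`.
Let `A` be a finite-dimensional commutative `ℂ`-algebra, `D = finrank ℂ A`, presented as a LOCAL
algebra by a character `χ : A →ₐ[ℂ] ℂ` all of whose errors `a - χ a • 1` are nilpotent (so
`J = ker χ` is a nil ideal and `A = ℂ • 1 ⊕ J`). Then every pattern `σ ↦ ℓ (∏ i, u (σ i) i)`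
(`u : Fin n → Fin n → A`, `ℓ : A →ₗ[ℂ] ℂ`) is a scalar combination of at most `(n+1)^D · D^D`
transversal product patterns `σ ↦ ∏ i, E (σ i) i` with complex matrices `E`.

Proof.
* `J ^ D = ⊥` (`ker_pow_finrank_eq_bot`): `J` is nil, `A` is Artinian, so `J ≤ nilradical A` is
  nilpotent; the chain `A = J⁰ ≥ J¹ ≥ J² ≥ …` is strictly decreasing while nonzero (a stable step
  `J^(i+1) = J^i` propagates to `J^i = J^(i+k) = 0`), so each nonzero step costs a dimension and
  `J ^ finrank = ⊥` (`pow_finrank_eq_bot_of_isNilpotent`).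
* Coordinates (`exists_coordinates`): with a `ℂ`-basis `(b_β)_{β < d}` of `J` (`d + 1 = D` by
  rank–nullity) put `w none = 1`, `w (some β) = b_β`, `e none a = χ a`,
  `e (some β) a = β`-th coordinate of `a - χ a • 1`; then `a = Σ_k e k a • w k` for every `a`.
* Expansion (`apply_prod_eq_sum`): multiplying out,
  `ℓ (∏ i, x i) = Σ_{β : Fin n → Option (Fin d)} ℓ (∏ i, w (β i)) · ∏ i, e (β i) (x i)`, and the
  term of `β` vanishes as soon as `β` takes `≥ D` non-`none` values (`prod_eq_zero_of_le_card`: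
  the product of `≥ D` elements of `J` lies in `J ^ D = ⊥`).
* Count (`card_subtype_le`): partial maps `β : Fin n → Option (Fin d)` with fewer than `D` values
  are encoded injectively by the padded lists of their support points and of their values,
  `(Fin D → Option (Fin n)) × (Fin D → Option (Fin d))`, whence at most
  `(n+1)^D (d+1)^D = (n+1)^D D^D` of them.

Sources: folklore (nilpotent filtration of a local Artinian algebra; "junta" expansion).
-/

-- `Summit.<Summit>.<Problem>` repeats `ValiantsHypothesis` by the tree's layout convention (D-0017).
set_option linter.dupNamespace false

namespace Summit.ValiantsHypothesis.ValiantsHypothesis.Theorems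

namespace FermionizationDimensionSDimPerNotQPLocalExpansion

open Module

/-- **Nilpotent ideals of a finite-dimensional algebra die at the dimension.** If `I` is a
nilpotent ideal of a commutative algebra `A` of finite dimension over a field `K`, then
`I ^ finrank K A = ⊥`: the chain `I⁰ ≥ I¹ ≥ …` is strictly decreasing while nonzero, since a
stable step `I^(i+1) = I^i` gives `I^i = I^(i+k) ≤ I^k = 0`. [folklore] -/
theorem pow_finrank_eq_bot_of_isNilpotent {K B : Type*} [Field K] [CommRing B] [Algebra K B]
    [Module.Finite K B] {I : Ideal B} (hI : IsNilpotent I) : I ^ finrank K B = ⊥ := by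
  obtain ⟨k, hk⟩ := hI
  -- a stable step forces vanishing
  have hstep : ∀ i, I ^ (i + 1) = I ^ i → I ^ i = ⊥ := by
    intro i h
    have hstab : ∀ m, I ^ (i + m) = I ^ i := by
      intro m
      induction m with
      | zero => rw [Nat.add_zero]
      | succ m ih => rw [← add_assoc, pow_succ', ih, ← pow_succ', h]
    have hle : I ^ i ≤ ⊥ :=
      calc I ^ i = I ^ (i + k) := (hstab k).symm
        _ ≤ I ^ k := Ideal.pow_le_pow_right (Nat.le_add_left k i)
        _ = ⊥ := by rw [hk, Ideal.zero_eq_bot]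
    exact le_bot_iff.1 hle
  -- dimension count along the chain
  have key : ∀ i, I ^ i = ⊥ ∨ finrank K ↥((I ^ i).restrictScalars K) + i ≤ finrank K B := by
    intro i
    induction i with
    | zero =>
      right
      rw [pow_zero, Ideal.one_eq_top, Submodule.restrictScalars_top, finrank_top, Nat.add_zero]
    | succ i ih =>
      by_cases hbot : I ^ i = ⊥
      · left
        rw [pow_succ, hbot, ← Ideal.zero_eq_bot, zero_mul]
      · right
        rcases ih with h | h
        · exact absurd h hbot
        · have hlt : I ^ (i + 1) < I ^ i :=
            lt_of_le_of_ne (Ideal.pow_le_pow_right (Nat.le_succ i)) fun heq => hbot (hstep i heq)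
          have hlt' : (I ^ (i + 1)).restrictScalars K < (I ^ i).restrictScalars K :=
            lt_of_le_of_ne (fun x hx => hlt.le hx) fun heq =>
              hlt.ne (Submodule.restrictScalars_injective K B B heq)
          have := Submodule.finrank_lt_finrank_of_lt hlt'
          omega
  rcases key (finrank K B) with h | h
  · exact h
  · have h0 : finrank K ↥((I ^ finrank K B).restrictScalars K) = 0 := by omega
    exact (Submodule.restrictScalars_eq_bot_iff K B B).1 (Submodule.finrank_eq_zero.1 h0)

variable {A : Type} [CommRing A] [Algebra ℂ A] [Module.Finite ℂ A]

/-- **The kernel of a local character dies at the dimension.** If every `a - χ a • 1` is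
nilpotent then `ker χ` is a nil ideal of the Artinian ring `A`, hence nilpotent
(`ker χ ≤ nilradical A`), hence `(ker χ) ^ finrank ℂ A = ⊥`. [folklore] -/
theorem ker_pow_finrank_eq_bot (χ : A →ₐ[ℂ] ℂ)
    (hχ : ∀ a : A, IsNilpotent (a - algebraMap ℂ A (χ a))) :
    RingHom.ker χ ^ finrank ℂ A = ⊥ := by
  haveI : IsArtinianRing A := IsArtinianRing.of_finite ℂ A
  apply pow_finrank_eq_bot_of_isNilpotent
  obtain ⟨k, hk⟩ := IsArtinianRing.isNilpotent_nilradical (R := A)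
  have hle : RingHom.ker χ ≤ nilradical A := fun x hx => by
    rw [mem_nilradical]
    have h := hχ x
    rwa [RingHom.mem_ker.1 hx, map_zero, sub_zero] at h
  refine ⟨k, le_antisymm ?_ ?_⟩
  · calc RingHom.ker χ ^ k ≤ nilradical A ^ k := Ideal.pow_right_mono hle k
      _ = 0 := hk
  · rw [Ideal.zero_eq_bot]
    exact bot_le

/-- **Coordinates adapted to the character.** With `V = ker χ` (of dimension `d`,
`d + 1 = finrank ℂ A` by rank–nullity) and a basis `(b_β)_{β<d}` of `V`: `w none = 1`,
`w (some β) = b_β ∈ ker χ`, `e none a = χ a`, `e (some β) a =` the `β`-th coordinate of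
`a - χ a • 1 ∈ V`, and every `a` decomposes as `a = Σ_k e k a • w k`. [folklore] -/
theorem exists_coordinates (χ : A →ₐ[ℂ] ℂ) :
    ∃ d : ℕ, d + 1 = finrank ℂ A ∧
      ∃ (w : Option (Fin d) → A) (e : Option (Fin d) → A → ℂ),
        w none = 1 ∧ (∀ b, w (some b) ∈ RingHom.ker χ) ∧ ∀ a, ∑ k, e k a • w k = a := by
  let V : Submodule ℂ A := LinearMap.ker χ.toLinearMap
  have hmemV : ∀ a : A, a - algebraMap ℂ A (χ a) ∈ V := fun a => by
    simp [V, LinearMap.mem_ker]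
  let bV := Module.finBasis ℂ V
  refine ⟨finrank ℂ V, ?_, fun k => k.elim 1 fun b => (bV b : A),
    fun k a => k.elim (χ a) fun b => bV.repr ⟨_, hmemV a⟩ b, rfl, fun b => ?_, fun a => ?_⟩
  · -- rank–nullity for the surjective functional `χ`
    have h := LinearMap.finrank_range_add_finrank_ker χ.toLinearMap
    rw [LinearMap.range_eq_top.2 (fun c => ⟨algebraMap ℂ A c, by simp⟩), finrank_top,
      Module.finrank_self] at h
    change finrank ℂ ↥(LinearMap.ker χ.toLinearMap) + 1 = finrank ℂ A
    omega
  · exact RingHom.mem_ker.2 (LinearMap.mem_ker.1 (bV b).2)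
  · rw [Fintype.sum_option]
    simp only [Option.elim_none, Option.elim_some]
    have hsum : ∑ b, bV.repr ⟨_, hmemV a⟩ b • (bV b : A) = a - algebraMap ℂ A (χ a) := by
      have h := congrArg Subtype.val (bV.sum_repr ⟨_, hmemV a⟩)
      simp only [Submodule.coe_sum, Submodule.coe_smul] at h
      exact h
    rw [hsum, Algebra.algebraMap_eq_smul_one, add_sub_cancel]

omit [Module.Finite ℂ A] in
/-- **Multiplying out.** If every `a` decomposes as `a = Σ_k e k a • w k` then, for any linear
functional `ℓ`, `ℓ (∏ i, x i) = Σ_{β : Fin n → Option (Fin d)} ℓ (∏ i, w (β i)) · ∏ i, e (β i) (x i)`.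
[folklore] -/
theorem apply_prod_eq_sum {n d : ℕ} (w : Option (Fin d) → A) (e : Option (Fin d) → A → ℂ)
    (h : ∀ a, ∑ k, e k a • w k = a) (x : Fin n → A) (ℓ : A →ₗ[ℂ] ℂ) :
    ℓ (∏ i, x i) = ∑ β : Fin n → Option (Fin d), ℓ (∏ i, w (β i)) * ∏ i, e (β i) (x i) := by
  have hx : ∏ i, x i = ∏ i, ∑ k, e k (x i) • w k :=
    Finset.prod_congr rfl fun i _ => (h (x i)).symm
  rw [hx, Fintype.prod_sum (fun i k => e k (x i) • w k), map_sum]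
  refine Finset.sum_congr rfl fun β _ => ?_
  rw [Finset.prod_smul, map_smul, smul_eq_mul, mul_comm]

/-- **Vanishing of long products.** If `J ^ D = ⊥` and all `w (some b) ∈ J`, then
`∏ i, w (β i) = 0` as soon as `β` takes at least `D` values: the support part of the product is a
product of `≥ D` elements of `J`, i.e. lies in `J ^ #supp ≤ J ^ D = ⊥`. [folklore] -/
theorem prod_eq_zero_of_le_card {B : Type*} [CommRing B] {n d D : ℕ} {J : Ideal B}
    (hJ : J ^ D = ⊥) (w : Option (Fin d) → B) (hw : ∀ b, w (some b) ∈ J)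
    (β : Fin n → Option (Fin d)) (hβ : D ≤ (Finset.univ.filter fun i => β i ≠ none).card) :
    ∏ i, w (β i) = 0 := by
  have hmem : ∏ i ∈ Finset.univ.filter (fun i => β i ≠ none), w (β i) ∈
      J ^ (Finset.univ.filter fun i => β i ≠ none).card := by
    rw [← Finset.prod_const J]
    exact Ideal.prod_mem_prod fun i hi => by
      obtain ⟨b, hb⟩ := Option.ne_none_iff_exists'.1 (Finset.mem_filter.1 hi).2
      rw [hb]
      exact hw b
  have hzero : ∏ i ∈ Finset.univ.filter (fun i => β i ≠ none), w (β i) = 0 := by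
    rw [← Ideal.mem_bot, ← hJ]
    exact Ideal.pow_le_pow_right hβ hmem
  rw [← Finset.prod_mul_prod_compl (Finset.univ.filter fun i => β i ≠ none) (fun i => w (β i)),
    hzero, zero_mul]

/-- **Counting partial assignments with few values.** The partial maps `β : Fin n → Option (Fin m)`
taking fewer than `D` values inject into `(Fin D → Option (Fin n)) × (Fin D → Option (Fin m))`
(the padded list of the support points, in increasing order, and the padded list of the values
there), so there are at most `(n+1)^D (m+1)^D` of them. [folklore] -/
theorem card_subtype_le (n m D : ℕ) :
    Fintype.card {β : Fin n → Option (Fin m) // (Finset.univ.filter fun i => β i ≠ none).card < D} ≤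
      (n + 1) ^ D * (m + 1) ^ D := by
  -- the encoding: padded lists of the support points (in increasing order) and of the values
  let enc : {β : Fin n → Option (Fin m) // (Finset.univ.filter fun i => β i ≠ none).card < D} →
      (Fin D → Option (Fin n)) × (Fin D → Option (Fin m)) := fun β =>
    (fun k => if h : (k : ℕ) < (Finset.univ.filter fun i => β.1 i ≠ none).card then
        some ((Finset.univ.filter fun i => β.1 i ≠ none).orderEmbOfFin rfl ⟨k, h⟩) else none,
     fun k => if h : (k : ℕ) < (Finset.univ.filter fun i => β.1 i ≠ none).card then
        β.1 ((Finset.univ.filter fun i => β.1 i ≠ none).orderEmbOfFin rfl ⟨k, h⟩) else none)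
  -- decoding: `β i` is the value listed against the support point `i`, `none` if `i` is unlisted
  have key : ∀ (β : {β : Fin n → Option (Fin m) //
        (Finset.univ.filter fun i => β i ≠ none).card < D})
      (p : (Fin D → Option (Fin n)) × (Fin D → Option (Fin m))), enc β = p → ∀ i : Fin n,
      β.1 i = if h : ∃ k, p.1 k = some i then p.2 h.choose else none := by
    rintro ⟨β, hβ⟩ _ rfl i
    split_ifs with h
    · have hspec := h.choose_spec
      simp only [enc] at hspec ⊢
      by_cases hlt : ((h.choose : Fin D) : ℕ) < (Finset.univ.filter fun i => β i ≠ none).card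
      · rw [dif_pos hlt] at hspec ⊢
        rw [Option.some_inj.1 hspec]
      · rw [dif_neg hlt] at hspec
        exact absurd hspec (by simp)
    · by_contra hne
      refine h ?_
      have hi : i ∈ ((Finset.univ.filter fun i => β i ≠ none : Finset (Fin n)) : Set (Fin n)) :=
        Finset.mem_coe.2 (Finset.mem_filter.2 ⟨Finset.mem_univ i, hne⟩)
      rw [← Finset.range_orderEmbOfFin (Finset.univ.filter fun i => β i ≠ none) rfl] at hi
      obtain ⟨k, hk⟩ := Set.mem_range.1 hi
      exact ⟨⟨k, lt_trans k.2 hβ⟩, by simp [enc, hk]⟩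
  have hinj : Function.Injective enc := fun β β' h =>
    Subtype.ext (funext fun i => (key β _ h i).trans (key β' _ rfl i).symm)
  calc Fintype.card {β : Fin n → Option (Fin m) //
          (Finset.univ.filter fun i => β i ≠ none).card < D}
      ≤ Fintype.card ((Fin D → Option (Fin n)) × (Fin D → Option (Fin m))) :=
        Fintype.card_le_of_injective enc hinj
    _ = (n + 1) ^ D * (m + 1) ^ D := by
        simp only [Fintype.card_prod, Fintype.card_fun, Fintype.card_option, Fintype.card_fin]

end FermionizationDimensionSDimPerNotQPLocalExpansion

open FermionizationDimensionSDimPerNotQPLocalExpansion in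
/-- **Calibration L — the local expansion bound** (stub `stub_localExpansion` of the line
`registered` of crux `SDimPerNotQP`, stmt-ValiantsHypothesis-7286). Over a finite-dimensional
commutative `ℂ`-algebra `A`, `D = finrank ℂ A`, that is local for the character `χ` (all
`a - χ a • 1` nilpotent), every pattern `σ ↦ ℓ (∏ i, u (σ i) i)` is a scalar combination of at
most `(n+1)^D · D^D` transversal product patterns `σ ↦ ∏ i, E (σ i) i`. Junta expansion: write
`u a i = χ (u a i) • 1 + ν a i` with `ν a i ∈ J = ker χ`, multiply out along a basis of `J`,
kill every term with `≥ D` factors from `J` (`J ^ D = ⊥`), and count the surviving partial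
assignments. [folklore] -/
theorem stub_localExpansion :
    ∀ (n : ℕ) (A : Type) [CommRing A] [Algebra ℂ A] [Module.Finite ℂ A] (χ : A →ₐ[ℂ] ℂ), (∀ a : A, IsNilpotent (a - algebraMap ℂ A (χ a))) → ∀ (u : Fin n → Fin n → A) (ℓ : A →ₗ[ℂ] ℂ), ∃ (T : Type) (_ : Fintype T) (c : T → ℂ) (E : T → Fin n → Fin n → ℂ), Fintype.card T ≤ (n + 1) ^ Module.finrank ℂ A * Module.finrank ℂ A ^ Module.finrank ℂ A ∧ ∀ σ : Equiv.Perm (Fin n), ℓ (∏ i, u (σ i) i) = ∑ t, c t * ∏ i, E t (σ i) i := by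
  intro n A _ _ _ χ hχ u ℓ
  obtain ⟨d, hd, w, e, -, hw, hdec⟩ := exists_coordinates χ
  have hJ := ker_pow_finrank_eq_bot χ hχ
  refine ⟨{β : Fin n → Option (Fin d) //
      (Finset.univ.filter fun i => β i ≠ none).card < Module.finrank ℂ A}, inferInstance,
    fun t => ℓ (∏ i, w (t.1 i)), fun t a i => e (t.1 i) (u a i), ?_, fun σ => ?_⟩
  · -- the count
    calc Fintype.card {β : Fin n → Option (Fin d) //
            (Finset.univ.filter fun i => β i ≠ none).card < Module.finrank ℂ A}
        ≤ (n + 1) ^ Module.finrank ℂ A * (d + 1) ^ Module.finrank ℂ A :=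
          card_subtype_le n d (Module.finrank ℂ A)
      _ = (n + 1) ^ Module.finrank ℂ A * Module.finrank ℂ A ^ Module.finrank ℂ A := by rw [hd]
  · -- the representation: expand, then drop the vanishing long terms
    rw [apply_prod_eq_sum w e hdec (fun i => u (σ i) i) ℓ]
    have hvan : ∀ β : Fin n → Option (Fin d),
        ¬ (Finset.univ.filter fun i => β i ≠ none).card < Module.finrank ℂ A →
        ℓ (∏ i, w (β i)) * ∏ i, e (β i) (u (σ i) i) = 0 := fun β hβ => by
      rw [prod_eq_zero_of_le_card hJ w hw β (not_lt.1 hβ), map_zero, zero_mul]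
    rw [← Finset.sum_filter_of_ne (s := Finset.univ)
      (p := fun β : Fin n → Option (Fin d) =>
        (Finset.univ.filter fun i => β i ≠ none).card < Module.finrank ℂ A)
      (fun β _ hne => not_not.1 fun h => hne (hvan β h))]
    exact Finset.sum_subtype _ (fun β => by simp) _

end Summit.ValiantsHypothesis.ValiantsHypothesis.Theorems
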